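import Literature.NumberTheory.ComplexMultiplication.KottwitzSignatureReflexField
import Mathlib.Algebra.Polynomial.Lifts
import Mathlib.NumberTheory.NumberField.Norm
import Mathlib.RingTheory.Norm.Transitivity
import HarnessLib

/-!
# Kottwitz's determinant polynomial `det(X − a ∣ V₁) = ∏_φ (X − φ(a))^{r_φ}` has coefficients in `𝒪_E` for `a ∈ 𝒪_F`
# («In fact they lie in `𝒪_E ⊗_ℤ ℤ_(p)`»); Kudla–Rapoport's `(T − φ(a))^{n−r}(T − φ(aˢ))^r` is the case `F` imaginary quadratic,
# and for `2r = n` it is `(T² − Tr(a)T + N(a))^r ∈ ℤ[T]`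

Layer `Literature/NumberTheory/ComplexMultiplication`, namespace `Literature.NumberTheory.ComplexMultiplication` (lane
`lit-hodgefound`, Track 2 foundations, Layer A3; seat `lit-hodgefound-p11`, generation 29, row g29-#2).  Sequel of
`KottwitzSignatureReflexField` (g28-#4, §3: «these coefficients lie in `E`» — `coeff_prod_X_sub_C_pow_mem_adjoin_sum`).
THEOREMS ONLY (D-0026): no definition, no named fact, no instance.  Kottwitz's reflex field `E_r` is WRITTEN OUT as
`IntermediateField.adjoin ℚ (Set.range fun a : F => ∑ φ : F →+* ℂ, (r φ : ℂ) * φ a)` exactly as in g28-#4.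

THE PRINTS.  R. E. Kottwitz, *Points on some Shimura varieties over finite fields*, J. Amer. Math. Soc. 5 (1992)
[Kottwitz1992] §5 pp. 389–390 (held text `paper:doi-10-2307-2152772` p0017 L45–L50, p0018 L1–L3), verbatim: «Choose a
basis `α₁, …, α_t` for the free `ℤ_(p)`-module `𝒪_B`, and let `X₁, …, X_t` be indeterminates.  Then
`f(X₁, …, X_t) := det(X₁α₁ + ⋯ + X_tα_t; V₁)` is a homogeneous polynomial of degree `dim_ℂ(V₁)` in `X₁, …, X_t` with
coefficients in `ℂ`; since the isomorphism class of `V₁` is defined over `E`, these coefficients lie in `E`.  In fact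
they lie in `𝒪_E ⊗_ℤ ℤ_(p)`, where `𝒪_E` denotes the ring of integers in `E`.  For this it is enough to check that they
lie in `𝒪_{E′} ⊗_ℤ ℤ_(p)` for some finite extension field `E′` of `E` over which `V₁` can be defined.  But then, in a
suitable basis, the matrix entries of `α₁, …, α_t` (acting on `V₁`) are in `𝒪_{E′} ⊗_ℤ ℤ_(p)`, and it follows that
`f(X₁, …, X_t)` has coefficients in `𝒪_{E′} ⊗_ℤ ℤ_(p)`.» and p. 390 «We require that the quadruple `(A, λ, i, η̄)`
satisfy the “determinant condition.” … it makes sense to require that `g(X₁, …, X_t)` be equal to the polynomial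
`f(X₁, …, X_t)` constructed earlier» (the comparison takes place over `𝒪_S` for `S` over `𝒪_E ⊗ ℤ_(p)`, which is why
the coefficients must be INTEGRAL elements of `E`).  S. Kudla, M. Rapoport, *Special cycles on unitary Shimura
varieties II* [KudlaRapoport2013] §2 eq. (2.1) (arXiv text p0006 L18): «`char(T, ι(a) ∣ Lie A) = (T − a)^{n−r}(T − aˢ)^r`,
`a ∈ 𝒪_k`» (a polynomial identity in `𝒪_S[T]`, `S` an `𝒪_k`-scheme) and §4 eq. (4.2) (p0014): «`det(T − ι(a) ∣ Lie(A))
= (T − φ(a))^{n−r}(T − φ(aˢ))^r ∈ 𝒪_S[T]`», §4.1 footnote: «In the case where `n` is even and `r = n−r`, the reflex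
field is `ℚ`».  M. Rapoport, B. Smithling, W. Zhang [RapoportSmithlingZhang2017] §3.2 eq. (3.4)/(3.5) (the same
conditions over `𝒪_E`, `𝒪_F`-action).

HERE `B = F` is a number field and `V₁ = ⊕_φ φ^{r_φ}`, so that in one variable `det(X − a ∣ V₁) = ∏_φ (X − φ(a))^{r_φ}`
(the reading of g28-#4 §3); Kottwitz's proof («in a suitable basis the matrix entries are integral») becomes: for
`a ∈ 𝒪_F` every `φ(a)` is an algebraic integer, so `∏_φ (X − φ(a))^{r_φ}` has algebraic-integer coefficients; they lie in
`E = E_r` by g28-#4, hence in `𝒪_E = E ∩ ℤ̄`.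

WHAT IS PROVED (`F` a number field, `r : (F →+* ℂ) → ℕ`, `a : 𝓞 F`).
§1 `monic_prod_X_sub_C_pow`, `natDegree_prod_X_sub_C_pow` (`= ∑_φ r_φ = dim V₁`), **`isIntegral_coeff_prod_X_sub_C_pow`**
   (every coefficient of `∏_φ (X − φ(a))^{r_φ}` is integral over `ℤ`), `isIntegral_sum_natCast_mul_apply`
   (`tr(a ∣ V₁) = ∑ r_φ φ(a)` is an algebraic integer), `isIntegral_prod_apply_pow` (`det(a ∣ V₁)`).
§2 **KOTTWITZ «In fact they lie in `𝒪_E`»**: **`coeff_prod_X_sub_C_pow_mem_range_ringOfIntegers`** (each coefficient is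
   the image of an element of `𝓞 E_r`), **`exists_monic_map_eq_prod_X_sub_C_pow`** (`∏_φ (X − φ(a))^{r_φ}` is the image
   of a MONIC polynomial over `𝓞 E_r` of degree `∑ r_φ` — the polynomial one compares with `char(T, ι(a) ∣ Lie A)` over
   `𝒪_E`-schemes), `sum_natCast_mul_apply_mem_range_ringOfIntegers`, `prod_apply_pow_mem_range_ringOfIntegers`.
§3 `F` IMAGINARY QUADRATIC (`F` CM, `[F : ℚ] = 2`, `φ₀ : F → ℂ`, `aˢ = ā` the complex conjugation OF `F`):
   **`prod_X_sub_C_pow_eq_map_of_finrank_eq_two`** — Kottwitz's polynomial for the signature `(r_{φ₀}, r_{φ̄₀}) = (n−s, s)`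
   IS Kudla–Rapoport's `(T − φ₀(a))^{n−s}(T − φ₀(aˢ))^s = ((T − a)^{n−s}(T − aˢ)^s)^{φ₀}` (a polynomial over `𝓞_F` read
   through `φ₀`, as in (2.1)); `X_sub_C_mul_X_sub_C_conjugate_eq_map` (`(T − φ₀ a)(T − φ₀ aˢ) = (T² − Tr(a)T + N(a))^{ℂ}`
   with `Tr`, `N` the trace and norm to `ℚ`), and **`prod_X_sub_C_pow_eq_map_int_of_two_mul_eq`** — in the pure case
   `2s = n` the polynomial is `((T² − Tr(a)T + N(a))^s)^{ℂ}` with `Tr(a), N(a) ∈ ℤ`: it is defined over `ℤ`, matching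
   «the reflex field is `ℚ`» (g29-#1 `adjoin_sum_eq_bot_iff_apply_eq_of_finrank_eq_two`).

## References

* [Kottwitz1992] R. E. Kottwitz, *Points on some Shimura varieties over finite fields*, J. Amer. Math. Soc. 5 (1992)
  373–444, §5 pp. 389–390.
* [KudlaRapoport2013] S. Kudla, M. Rapoport, *Special cycles on unitary Shimura varieties II: global theory*, J. reine
  angew. Math. 697 (2014) 91–157 (arXiv:0912.3758): §2 eq. (2.1), Prop. 2.1; §4 eq. (4.2), §4.1 footnote.
* [RapoportSmithlingZhang2017] M. Rapoport, B. Smithling, W. Zhang, *Arithmetic diagonal cycles on unitary Shimura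
  varieties*, Compositio Math. 156 (2020), §3.2 eq. (3.4), (3.5).
* [NeukirchANT1999] J. Neukirch, *Algebraic Number Theory* (1999), Ch. I §2 (algebraic integers form a ring; (2.6) trace and
  norm as sum/product over the embeddings, integrality of trace and norm).

## Provenance

Lane `lit-hodgefound` (HOME `run/shared/lean/pub/lit-hodgefound/`), prover seat `lit-hodgefound-p11` (gen 29),
self-proposed row g29-#2 (lane INBOX claim 2026-08-27), sequel of `KottwitzSignatureReflexField` (g28-#4) and
`KottwitzSignatureReflexFieldRationalOrCM` (g29-#1).
-/

set_option autoImplicit false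

noncomputable section

open scoped Polynomial Classical ComplexConjugate
open NumberField Module IntermediateField Polynomial

namespace Literature.NumberTheory.ComplexMultiplication

variable {F : Type} [Field F] [NumberField F]

/-! ## §1 `∏_φ (X − φ(a))^{r_φ}` for `a ∈ 𝒪_F`: monic of degree `∑ r_φ`, algebraic-integer coefficients -/

section Integral

variable (r : (F →+* ℂ) → ℕ)

/-- `det(X − a ∣ V₁) = ∏_φ (X − φ(a))^{r_φ}` is monic. [cite: Kottwitz1992, §5 p. 390] -/
theorem monic_prod_X_sub_C_pow (a : F) : (∏ φ : F →+* ℂ, (X - C (φ a)) ^ r φ).Monic :=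
  monic_prod_of_monic _ _ fun φ _ => (monic_X_sub_C (φ a)).pow (r φ)

/-- `deg det(X − a ∣ V₁) = ∑_φ r_φ = dim_ℂ V₁` («a homogeneous polynomial of degree `dim_ℂ(V₁)`»). [cite: Kottwitz1992, §5 p. 390] -/
theorem natDegree_prod_X_sub_C_pow (a : F) : (∏ φ : F →+* ℂ, (X - C (φ a)) ^ r φ).natDegree = ∑ φ : F →+* ℂ, r φ := by
  rw [natDegree_prod_of_monic _ _ fun φ _ => (monic_X_sub_C (φ a)).pow (r φ)]
  exact Finset.sum_congr rfl fun φ _ => by rw [((monic_X_sub_C (φ a)).natDegree_pow (r φ)), natDegree_X_sub_C, mul_one]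

omit [NumberField F] in
/-- `φ(a)` is an algebraic integer for `a ∈ 𝒪_F`. [cite: NeukirchANT1999, Ch. I §2 (conjugates of integers are integers)] -/
theorem isIntegral_apply_coe (φ : F →+* ℂ) (a : 𝓞 F) : IsIntegral ℤ (φ (a : F)) :=
  (RingOfIntegers.isIntegral_coe a).map φ.toIntAlgHom

/-- **The coefficients of `∏_φ (X − φ(a))^{r_φ}` are algebraic integers for `a ∈ 𝒪_F`** («in a suitable basis, the matrix
entries … are in `𝒪_{E′}`, and it follows that `f` has coefficients in `𝒪_{E′}`»: here the roots `φ(a)` are integral and the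
integral elements of `ℂ` form a subring). [cite: Kottwitz1992, §5 pp. 389–390] [cite: NeukirchANT1999, Ch. I §2 (integral closure is a ring)] -/
theorem isIntegral_coeff_prod_X_sub_C_pow (a : 𝓞 F) (k : ℕ) :
    IsIntegral ℤ ((∏ φ : F →+* ℂ, (X - C (φ (a : F))) ^ r φ).coeff k) := by
  -- the polynomial is the image of a polynomial over the integral closure `ℤ̄ ⊂ ℂ`
  let R : Subalgebra ℤ ℂ := integralClosure ℤ ℂ
  let Q : R[X] := ∏ φ : F →+* ℂ, (X - C (⟨φ (a : F), isIntegral_apply_coe φ a⟩ : R)) ^ r φ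
  have hQ : Q.map (algebraMap R ℂ) = ∏ φ : F →+* ℂ, (X - C (φ (a : F))) ^ r φ := by
    simp only [Q, Polynomial.map_prod, Polynomial.map_pow, Polynomial.map_sub, map_X, map_C]
    rfl
  rw [← hQ, coeff_map]
  exact (Q.coeff k).2

/-- The trace `tr(a ∣ V₁) = ∑_φ r_φ φ(a)` is an algebraic integer for `a ∈ 𝒪_F`. [cite: Kottwitz1992, §5 pp. 389–390]
[cite: NeukirchANT1999, Ch. I §2] -/
theorem isIntegral_sum_natCast_mul_apply (a : 𝓞 F) : IsIntegral ℤ (∑ φ : F →+* ℂ, (r φ : ℂ) * φ (a : F)) :=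
  IsIntegral.sum _ fun φ _ => by
    have h : IsIntegral ℤ ((r φ : ℕ) : ℂ) := by
      simpa using isIntegral_algebraMap (R := ℤ) (A := ℂ) (x := (r φ : ℤ))
    exact h.mul (isIntegral_apply_coe φ a)

/-- The determinant `det(a ∣ V₁) = ∏_φ φ(a)^{r_φ}` is an algebraic integer for `a ∈ 𝒪_F`. [cite: Kottwitz1992, §5 pp. 389–390]
[cite: NeukirchANT1999, Ch. I §2] -/
theorem isIntegral_prod_apply_pow (a : 𝓞 F) : IsIntegral ℤ (∏ φ : F →+* ℂ, φ (a : F) ^ r φ) :=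
  IsIntegral.prod _ fun φ _ => (isIntegral_apply_coe φ a).pow (r φ)

end Integral

/-! ## §2 Kottwitz: «In fact they lie in `𝒪_E`» — the coefficients come from the ring of integers of `E_r` -/

section RingOfIntegers

variable (r : (F →+* ℂ) → ℕ)

/-- An element of `E_r ⊂ ℂ` which is integral over `ℤ` is (the image of) an element of `𝓞 E_r`. [cite: NeukirchANT1999, Ch. I §2 (definition of `𝒪_K`)] -/
theorem mem_range_ringOfIntegers_of_mem_of_isIntegral {E : IntermediateField ℚ ℂ} {z : ℂ} (hz : z ∈ E)
    (hint : IsIntegral ℤ z) : z ∈ Set.range fun b : 𝓞 E => ((b : E) : ℂ) := by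
  have hint' : IsIntegral ℤ (⟨z, hz⟩ : E) :=
    (isIntegral_algebraMap_iff (R := ℤ) (A := E) (B := ℂ) (algebraMap E ℂ).injective).1 hint
  exact ⟨⟨⟨z, hz⟩, hint'⟩, rfl⟩

/-- **KOTTWITZ: the coefficients of `det(X − a ∣ V₁) = ∏_φ (X − φ(a))^{r_φ}`, `a ∈ 𝒪_F`, LIE IN `𝒪_E`** (they lie in
`E = E_r` — g28-#4 `coeff_prod_X_sub_C_pow_mem_adjoin_sum` — and are algebraic integers, §1).
[cite: Kottwitz1992, §5 pp. 389–390 («In fact they lie in `𝒪_E ⊗_ℤ ℤ_(p)`»)] -/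
theorem coeff_prod_X_sub_C_pow_mem_range_ringOfIntegers (a : 𝓞 F) (k : ℕ) :
    (∏ φ : F →+* ℂ, (X - C (φ (a : F))) ^ r φ).coeff k ∈
      Set.range fun b : 𝓞 (IntermediateField.adjoin ℚ (Set.range fun a : F => ∑ φ : F →+* ℂ, (r φ : ℂ) * φ a)) =>
        ((b : IntermediateField.adjoin ℚ (Set.range fun a : F => ∑ φ : F →+* ℂ, (r φ : ℂ) * φ a)) : ℂ) :=
  mem_range_ringOfIntegers_of_mem_of_isIntegral (coeff_prod_X_sub_C_pow_mem_adjoin_sum r (a : F) k)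
    (isIntegral_coeff_prod_X_sub_C_pow r a k)

/-- **`∏_φ (X − φ(a))^{r_φ} ∈ 𝒪_E[X]`: it is the image of a MONIC polynomial of degree `∑ r_φ` over `𝓞 E_r`** — the
polynomial `f` that the determinant condition «`g = f`» compares, over `𝒪_E`-schemes, with `char(X, ι(a) ∣ Lie A)`.
[cite: Kottwitz1992, §5 pp. 389–390] [cite: KudlaRapoport2013, §2 eq. (2.1)] [cite: RapoportSmithlingZhang2017, §3.2 eq. (3.4)] -/
theorem exists_monic_map_eq_prod_X_sub_C_pow (a : 𝓞 F) :
    ∃ Q : (𝓞 (IntermediateField.adjoin ℚ (Set.range fun a : F => ∑ φ : F →+* ℂ, (r φ : ℂ) * φ a)))[X],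
      Q.Monic ∧ Q.natDegree = ∑ φ : F →+* ℂ, r φ ∧
        Q.map (algebraMap _ ℂ) = ∏ φ : F →+* ℂ, (X - C (φ (a : F))) ^ r φ := by
  have hlifts : (∏ φ : F →+* ℂ, (X - C (φ (a : F))) ^ r φ) ∈ Polynomial.lifts
      (algebraMap (𝓞 (IntermediateField.adjoin ℚ (Set.range fun a : F => ∑ φ : F →+* ℂ, (r φ : ℂ) * φ a))) ℂ) := by
    rw [lifts_iff_coeff_lifts]
    intro k
    obtain ⟨b, hb⟩ := coeff_prod_X_sub_C_pow_mem_range_ringOfIntegers r a k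
    exact ⟨b, hb⟩
  obtain ⟨Q, hQ, hdeg, hmon⟩ := lifts_and_natDegree_eq_and_monic hlifts (monic_prod_X_sub_C_pow r (a : F))
  exact ⟨Q, hmon, hdeg.trans (natDegree_prod_X_sub_C_pow r (a : F)), hQ⟩

/-- The trace `∑_φ r_φ φ(a)` lies in `𝒪_E` for `a ∈ 𝒪_F`. [cite: Kottwitz1992, §5 pp. 389–390] -/
theorem sum_natCast_mul_apply_mem_range_ringOfIntegers (a : 𝓞 F) :
    ∑ φ : F →+* ℂ, (r φ : ℂ) * φ (a : F) ∈
      Set.range fun b : 𝓞 (IntermediateField.adjoin ℚ (Set.range fun a : F => ∑ φ : F →+* ℂ, (r φ : ℂ) * φ a)) =>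
        ((b : IntermediateField.adjoin ℚ (Set.range fun a : F => ∑ φ : F →+* ℂ, (r φ : ℂ) * φ a)) : ℂ) :=
  mem_range_ringOfIntegers_of_mem_of_isIntegral (IntermediateField.subset_adjoin ℚ _ ⟨(a : F), rfl⟩)
    (isIntegral_sum_natCast_mul_apply r a)

/-- The determinant `∏_φ φ(a)^{r_φ}` lies in `𝒪_E` for `a ∈ 𝒪_F`. [cite: Kottwitz1992, §5 pp. 389–390] -/
theorem prod_apply_pow_mem_range_ringOfIntegers (a : 𝓞 F) :
    ∏ φ : F →+* ℂ, φ (a : F) ^ r φ ∈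
      Set.range fun b : 𝓞 (IntermediateField.adjoin ℚ (Set.range fun a : F => ∑ φ : F →+* ℂ, (r φ : ℂ) * φ a)) =>
        ((b : IntermediateField.adjoin ℚ (Set.range fun a : F => ∑ φ : F →+* ℂ, (r φ : ℂ) * φ a)) : ℂ) :=
  mem_range_ringOfIntegers_of_mem_of_isIntegral (prod_apply_pow_mem_adjoin_sum r (a : F)) (isIntegral_prod_apply_pow r a)

end RingOfIntegers

/-! ## §3 `F` imaginary quadratic: Kudla–Rapoport's `(T − φ(a))^{n−r}(T − φ(aˢ))^r`, and the pure case `2r = n` over `ℤ` -/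

section ImaginaryQuadratic

variable [IsCMField F] (φ₀ : F →+* ℂ)

/-- An embedding of a CM field is not real: `φ̄₀ ≠ φ₀`. [cite: KudlaRapoport2013, §4 (the embedding `τ : k → ℂ`)] -/
private theorem conjugate_ne_kd : ComplexEmbedding.conjugate φ₀ ≠ φ₀ := fun h =>
  IsTotallyComplex.complexEmbedding_not_isReal φ₀ (ComplexEmbedding.isReal_iff.2 h)

/-- `Hom(F, ℂ) = {φ₀, φ̄₀}` for `[F : ℚ] = 2`. [folklore] -/
private theorem univ_eq_pair_kd (h2 : finrank ℚ F = 2) :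
    (Finset.univ : Finset (F →+* ℂ)) = {φ₀, ComplexEmbedding.conjugate φ₀} := by
  symm
  apply Finset.eq_univ_of_card
  rw [Finset.card_pair (conjugate_ne_kd φ₀).symm, Embeddings.card, h2]

/-- `φ̄₀(a) = φ₀(aˢ)` with `s` the complex conjugation of the CM field `F`. [cite: KudlaRapoport2013, §2 («`σ`» the nontrivial automorphism)] -/
theorem conjugate_apply_eq_apply_complexConj (a : F) :
    ComplexEmbedding.conjugate φ₀ a = φ₀ (IsCMField.complexConj F a) := by
  rw [ComplexEmbedding.conjugate_coe_eq, IsCMField.complexEmbedding_complexConj]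

/-- **KUDLA–RAPOPORT'S POLYNOMIAL IS KOTTWITZ'S**: for `[F : ℚ] = 2` and the signature `r` with values `r_{φ₀}`, `r_{φ̄₀}`,
`∏_φ (X − φ(a))^{r_φ} = ((X − a)^{r_{φ₀}} (X − aˢ)^{r_{φ̄₀}})^{φ₀}` — the polynomial `(T − a)^{n−r}(T − aˢ)^r ∈ 𝒪_k[T]`
of (2.1), read in `ℂ` through `φ₀` as in (4.2). [cite: KudlaRapoport2013, §2 eq. (2.1) and §4 eq. (4.2)]
[cite: Kottwitz1992, §5 p. 390] -/
theorem prod_X_sub_C_pow_eq_map_of_finrank_eq_two (h2 : finrank ℚ F = 2) (r : (F →+* ℂ) → ℕ) (a : F) :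
    ∏ φ : F →+* ℂ, (X - C (φ a)) ^ r φ =
      ((X - C a) ^ r φ₀ * (X - C (IsCMField.complexConj F a)) ^ r (ComplexEmbedding.conjugate φ₀)).map φ₀ := by
  rw [univ_eq_pair_kd φ₀ h2, Finset.prod_pair (conjugate_ne_kd φ₀).symm]
  simp only [Polynomial.map_mul, Polynomial.map_pow, Polynomial.map_sub, map_X, map_C,
    conjugate_apply_eq_apply_complexConj]

/-- The same for `a ∈ 𝒪_F`: `∏_φ (X − φ(a))^{r_φ}` is the image under `φ₀ : 𝒪_F → ℂ` of
`(X − a)^{r_{φ₀}}(X − aˢ)^{r_{φ̄₀}} ∈ 𝒪_F[X]` («`a ∈ 𝒪_k`», (2.1)). [cite: KudlaRapoport2013, §2 eq. (2.1)] -/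
theorem prod_X_sub_C_pow_eq_map_ringOfIntegers_of_finrank_eq_two (h2 : finrank ℚ F = 2) (r : (F →+* ℂ) → ℕ) (a : 𝓞 F) :
    ∏ φ : F →+* ℂ, (X - C (φ (a : F))) ^ r φ =
      ((X - C a) ^ r φ₀ * (X - C (RingOfIntegers.mapRingHom (IsCMField.complexConj F).toRingEquiv.toRingHom a)) ^
          r (ComplexEmbedding.conjugate φ₀)).map (φ₀.comp (algebraMap (𝓞 F) F)) := by
  rw [prod_X_sub_C_pow_eq_map_of_finrank_eq_two φ₀ h2 r (a : F), ← Polynomial.map_map]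
  congr 1
  simp only [Polynomial.map_mul, Polynomial.map_pow, Polynomial.map_sub, map_X, map_C]
  rfl

/-- **`(X − φ₀(a))(X − φ₀(aˢ)) = (X² − Tr_{F/ℚ}(a)·X + N_{F/ℚ}(a))^{ℂ}`** for `[F : ℚ] = 2` (trace and norm are the sum and the
product over the two embeddings `φ₀, φ̄₀`). [cite: NeukirchANT1999, Ch. I §2 (2.6) (ii)–(iii)] [cite: KudlaRapoport2013, §4.1 footnote] -/
theorem X_sub_C_mul_X_sub_C_conjugate_eq_map (h2 : finrank ℚ F = 2) (a : F) :
    (X - C (φ₀ a)) * (X - C (ComplexEmbedding.conjugate φ₀ a)) =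
      (X ^ 2 - C (Algebra.trace ℚ F a) * X + C (Algebra.norm ℚ a)).map (algebraMap ℚ ℂ) := by
  have htr : algebraMap ℚ ℂ (Algebra.trace ℚ F a) = φ₀ a + ComplexEmbedding.conjugate φ₀ a := by
    rw [trace_eq_sum_embeddings ℂ, ← Fintype.sum_equiv RingHom.equivRatAlgHom (fun φ : F →+* ℂ => φ a)
      (fun σ : F →ₐ[ℚ] ℂ => σ a) fun φ => rfl, univ_eq_pair_kd φ₀ h2, Finset.sum_pair (conjugate_ne_kd φ₀).symm]
  have hno : algebraMap ℚ ℂ (Algebra.norm ℚ a) = φ₀ a * ComplexEmbedding.conjugate φ₀ a := by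
    rw [Algebra.norm_eq_prod_embeddings, ← Fintype.prod_equiv RingHom.equivRatAlgHom (fun φ : F →+* ℂ => φ a)
      (fun σ : F →ₐ[ℚ] ℂ => σ a) fun φ => rfl, univ_eq_pair_kd φ₀ h2, Finset.prod_pair (conjugate_ne_kd φ₀).symm]
  simp only [Polynomial.map_add, Polynomial.map_sub, Polynomial.map_mul, Polynomial.map_pow, map_X, map_C, htr, hno,
    C_add, C_mul]
  ring

/-- **THE PURE CASE `2s = n` IS DEFINED OVER `ℚ`**: for the signature `(s, s)` (`r_{φ₀} = r_{φ̄₀} = s`) Kottwitz's polynomial is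
`((X² − Tr(a)X + N(a))^s)^{ℂ}` with `Tr(a), N(a) ∈ ℚ` — consistent with «in the case where `n` is even and `r = n − r`, the
reflex field is `ℚ`». [cite: KudlaRapoport2013, §4.1 footnote and §2 eq. (2.1)] [cite: Kottwitz1992, §5 p. 390] -/
theorem prod_X_sub_C_pow_eq_map_rat_of_apply_eq (h2 : finrank ℚ F = 2) (r : (F →+* ℂ) → ℕ)
    (hr : r φ₀ = r (ComplexEmbedding.conjugate φ₀)) (a : F) :
    ∏ φ : F →+* ℂ, (X - C (φ a)) ^ r φ =
      ((X ^ 2 - C (Algebra.trace ℚ F a) * X + C (Algebra.norm ℚ a)) ^ r φ₀).map (algebraMap ℚ ℂ) := by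
  rw [univ_eq_pair_kd φ₀ h2, Finset.prod_pair (conjugate_ne_kd φ₀).symm, ← hr, ← mul_pow,
    X_sub_C_mul_X_sub_C_conjugate_eq_map φ₀ h2 a, Polynomial.map_pow]

/-- **… AND OVER `ℤ` FOR `a ∈ 𝒪_F`**: `∏_φ (X − φ(a))^{s} = ((X² − Tr_{𝒪_F/ℤ}(a)X + N_{𝒪_F/ℤ}(a))^s)^{ℂ}` with INTEGER trace and
norm — the determinant condition of signature `(s, s)` is a condition over `ℤ`-schemes. [cite: KudlaRapoport2013, §4.1 footnote and §2 eq. (2.1)]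
[cite: NeukirchANT1999, Ch. I §2 (trace and norm of an algebraic integer are integers)] -/
theorem prod_X_sub_C_pow_eq_map_int_of_apply_eq (h2 : finrank ℚ F = 2) (r : (F →+* ℂ) → ℕ)
    (hr : r φ₀ = r (ComplexEmbedding.conjugate φ₀)) (a : 𝓞 F) :
    ∏ φ : F →+* ℂ, (X - C (φ (a : F))) ^ r φ =
      ((X ^ 2 - C (Algebra.trace ℤ (𝓞 F) a) * X + C (Algebra.norm ℤ a)) ^ r φ₀).map (algebraMap ℤ ℂ) := by
  have h : ((X ^ 2 - C (Algebra.trace ℤ (𝓞 F) a) * X + C (Algebra.norm ℤ a)) ^ r φ₀).map (algebraMap ℤ ℚ) =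
      (X ^ 2 - C (Algebra.trace ℚ F (a : F)) * X + C (Algebra.norm ℚ (a : F))) ^ r φ₀ := by
    rw [Polynomial.map_pow, Polynomial.map_add, Polynomial.map_sub, Polynomial.map_mul, Polynomial.map_pow, map_X,
      map_C, map_C, eq_intCast, eq_intCast, Algebra.coe_trace_int, Algebra.coe_norm_int]
  rw [prod_X_sub_C_pow_eq_map_rat_of_apply_eq φ₀ h2 r hr (a : F), ← h, Polynomial.map_map,
    RingHom.ext_int ((algebraMap ℚ ℂ).comp (algebraMap ℤ ℚ)) (algebraMap ℤ ℂ)]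

end ImaginaryQuadratic

end Literature.NumberTheory.ComplexMultiplication

end
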